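import Summits.BirchSwinnertonDyer.BirchSwinnertonDyer.Theorems.UniversalToricDescentThinCombFrameFunctionalEquation
import Summits.BirchSwinnertonDyer.BirchSwinnertonDyer.Theorems.UniversalToricDescentThinCombFrameSizeInvariance
import Summits.BirchSwinnertonDyer.BirchSwinnertonDyer.Theorems.UniversalToricDescentThinCombColumnTwistConst
import Literature.NumberTheory.EllipticCurves.CastellaGrossiSkinner2025.TwoVariablePAdicLFunctionII
import HarnessLib

/-!
# THE ORBIT THEOREM FOR ♯♯-FRAMES: any two non-zero ♯♯-frames `L`, `L′` of one datum satisfy `C·L′ = C′·[g₀]·L` for a GROUP ELEMENT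
# `g₀ ∈ Γ_K` — the non-zero frames form ONE orbit under `ℂ₃ˣ × Γ_K`
# (helper on the rational wall `RationalSplitIMCInclusionAtThree`, stmt-BirchSwinnertonDyer-24207, line `ratwall_thin_comb` v11/v12;
# cell `pub/bsd-wall`, LEAD `cruxlead-24207` g39; `--supports stmt-BirchSwinnertonDyer-24207`; nothing is closed; BSD is not proved)

WHY THIS FILE. The first stub of the line ((E) `ToricFrameExistsAtThree`, v11; (E|L) `ToricFrameExistsOfBDPFrameAtThree`, v12) is an
EXISTENCE statement: a ♯♯-frame `L₂ ∈ R₀⟦T₁⟧⟦T₂⟧` of the toric two-variable `3`-adic `L`-function of `f_E` with SOME constants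
`(C, X, Y) ∈ (ℂ₃ˣ)³` (`IsToricTwoVarLFunctionUpTo₂`). How many objects does it posit? The structure theory so far answers piecewise: a frame
is determined by its constants (`…FrameUniqueness` §1), frames whose constants differ by units of `ℤ₃` differ by a group-like unit (§2 there),
the reflected frame `φ_{A_τ}L₂` is `[g₀]·L₂` (`…FrameFunctionalEquation`), `‖Y/X‖` is forced (`…SizeRigidity`) and `‖X‖, ‖Y‖` are the same
for all non-zero frames (`…FrameSizeInvariance`, this gen). This file proves the statement all of these are shadows of:

* §1 `hasValueAt₂_C_C_mul`, `exists_norm_pow_mul_le_one` — values of constant multiples (`R₀`-coefficients; the `𝒪_{ℂ_p}` version is the tree's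
  `IntSeries.HasValueAt₂.const_mul`); `3`-power scaling into `𝒪_{ℂ₃}`.
* §2 **`exists_groupLike_of_isToricTwoVarLFunctionUpTo₂_pair`** — THE ORBIT THEOREM (`p = 3`, Jacquet's cone fact BY NAME): for two NON-ZERO
  ♯♯-frames `L` (constants `(C, X, Y)`) and `L′` (constants `(C′, X′, Y′)`) of the same datum `(ι′, 𝔭, 𝔭′, κ₁, κ₂, γ₁, γ₂, f_E, Ω_K)`, all
  constants non-zero, there is `g₀ ∈ Γ_K` with `C·L′ = C′·(1+T₁)^{κ₁g₀}(1+T₂)^{κ₂g₀}·L` — stated in `𝒪_{ℂ₃}⟦T₁⟧⟦T₂⟧` after multiplying both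
  constants by a common power `3^k` that makes them integral (`a = 3^k C`, `a′ = 3^k C′`). PROOF (the argument of `…FrameFunctionalEquation`
  for an ARBITRARY second frame in place of the reflected one): on the character grid (`…CharacterGrid`: `r_{ij}(g) = r₁(g)^{i+1} r₂(g)^{j+1}`)
  both frames interpolate the same display values, so `L′(P_{ij}) = (C′/C)·α^{i+1}·β^{j+1}·L(P_{ij})`, `α = (X′/X)^m`, `β = (Y′/Y)^m`; the WILD
  STEP in `T₁` on a fibre with a non-vanishing node (`…NodeSeries`, `PadicComplex.exists_padicInt_binomial_twist_of_node_values`) gives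
  `α = Q₁(u − 1)` for a normalised binomial solution, hence `g₁ ∈ Γ_K` with `r₁(g₁) = α` (`…BinomialValues`); the twisted frame `[g₁]·L` has
  `3^k L′(P_{ij}) = c·w^{j+1}·([g₁]L)(P_{ij})` with `w = β·r₂(g₁)⁻¹` of norm ONE (size invariance: `‖Y′‖ = ‖Y‖`) and `c = 3^k C′/C` integral; the
  COLUMN TWIST WITH A CONSTANT (`…ColumnTwistConst`) gives `w = Q₂(v₂ − 1)`, hence `g′` with coordinates `(0, e)`, `r₂(g′) = w`, `r₁(g′) = 1`;
  `g₀ = g₁g′` has `r₁(g₀) = α`, `r₂(g₀) = β`, so `a·L′ − a′·[g₀]L` vanishes on the grid, hence is zero (fibred identity principle in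
  `𝒪_{ℂ₃}⟦T₁⟧⟦T₂⟧`, `…ReflectionTransfer.int_eq_zero_of_infinite_zeros₂_innerFibred`).
* Corollaries (same constant `C` ⇒ `L′ = [g₀]·L` on the nose, `Associated L′ L`; different periods) are in the companion file
  `…ThinComb.FrameOrbitCorollaries` (400-line rule).
  READING for the typer / disprover of stub 1: (E)/(E|L) posit ONE object up to `ℂ₃ˣ × Γ_K` — whatever construction produces an integral
  two-variable interpolation at the additive split `3` (Hida's Rankin–Selberg measure, an integral refinement of Liu–Zhang–Zhang, …) produces THE
  frame up to a scalar and a group-like unit; item 32493's `∀ L₂` ranges over a single `ℂ₃ˣ·Γ_K`-orbit.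

HONEST SCOPE: statements about the interpolation predicate, conditional on the named print fact `jacquet1972_functionalEquation_rankinSelbergHecke_cone`;
nothing here is evidence that a frame exists at an additive split `3`; BSD is proved for no curve; 24207 / 20395 / 20186 / 32493 OPEN.

References: [cite: HaoLoeffler2025, Thm. 3.5 and remark, §4 Thm. 4.9 (arXiv:2405.12611)] [cite: CastellaWan2023, §2.4 Thm. 2.11 (arXiv:1607.02019)]
[cite: Robert2000PadicAnalysis, Ch. V §2.4 Theorem 1; Ch. VI §2.1–2.4] [cite: Gouvea1993PadicNumbers, §5.6 Cor. 5.6.3–5.6.4; §5.9 Problem 194]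
[cite: Jacquet1972, §19 Cor. 19.15] [cite: deShalit1987, II.4.17 (54), II.6.4] [cite: SerreAbelianLadic1968, Ch. III §2.3]
-/

set_option linter.dupNamespace false
set_option autoImplicit false

noncomputable section

open scoped Classical MatrixGroups
open Filter Topology

namespace Summit.BirchSwinnertonDyer.BirchSwinnertonDyer.Theorems.UniversalToricDescentThinComb.FrameOrbit

open NumberField IsDedekindDomain Field
open Literature.NumberTheory.EllipticCurves Literature.NumberTheory.GaloisRepresentations Literature.NumberTheory.LocalFields
open Summit.BirchSwinnertonDyer.Rank1Residual.X11b.Halves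
open Summit.BirchSwinnertonDyer.BirchSwinnertonDyer.Theorems.UniversalToricDescentThinComb

/-! ### §1. Values of constant multiples; `p`-power scaling into `𝒪_{ℂ_p}` -/

section Const

variable {p : ℕ} [Fact p.Prime]

/-- Values of `C (C a) · F` for `F ∈ R₀⟦T₁⟧⟦T₂⟧`: `a` times the values of `F`. [folklore] -/
theorem hasValueAt₂_C_C_mul {F : PowerSeries (UnrSeries p)} (a : unrIntegers p) {x y v : ℂ_[p]}
    (hF : UnrSeries.HasValueAt₂ F x y v) :
    UnrSeries.HasValueAt₂ (PowerSeries.C (PowerSeries.C a) * F) x y ((a : ℂ_[p]) * v) := by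
  unfold UnrSeries.HasValueAt₂ at *
  refine (hF.mul_left (a : ℂ_[p])).congr_fun fun k ↦ ?_
  rw [PowerSeries.coeff_C_mul, PowerSeries.coeff_C_mul]
  push_cast
  ring

/-- For finitely many `z ∈ ℂ_p` (here: a bound `M`) some power of `p` makes them integral: `‖p‖^k · M ≤ 1`. [folklore] -/
theorem exists_norm_pow_mul_le_one (M : ℝ) : ∃ k : ℕ, ‖(p : ℂ_[p])‖ ^ k * M ≤ 1 := by
  have hp1 : ‖(p : ℂ_[p])‖ < 1 := norm_prime_padicComplex_lt_one
  rcases le_or_gt M 0 with hM | hM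
  · exact ⟨0, by rw [pow_zero, one_mul]; exact hM.trans zero_le_one⟩
  · obtain ⟨k, hk⟩ := exists_pow_lt_of_lt_one (inv_pos.mpr hM) hp1
    exact ⟨k, by rw [← le_div_iff₀ hM, one_div]; exact hk.le⟩

end Const

/-! ### §2. The orbit theorem (`p = 3`) -/

variable {K : Type} [Field K] [NumberField K]

/-- **THE ORBIT THEOREM FOR ♯♯-FRAMES.** `K` imaginary quadratic Heegner for `N`, `3 = 𝔭𝔭′` with `𝔭` of degree one induced by `ι′`,
`(κ₁, κ₂; γ₁, γ₂)` a generator pair with `κ₁` unramified outside `𝔭`, `f = Dt.f`; Jacquet's cone fact BY NAME. Let `L ≠ 0` be a ♯♯-frame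
with constants `(C, X, Y)` and `L′ ≠ 0` a ♯♯-frame with constants `(C′, X′, Y′)`, for the same period `Ω_K`, all constants non-zero. Then there
are `g₀ ∈ Γ_K` and `k ∈ ℕ` such that, with the integral scalars `a = 3^k·C`, `a′ = 3^k·C′ ∈ 𝒪_{ℂ₃}`,
`a · L′ = a′ · (1+T₁)^{κ₁ g₀}(1+T₂)^{κ₂ g₀} · L` in `𝒪_{ℂ₃}⟦T₁⟧⟦T₂⟧` — i.e. `L′ = (C′/C)·[g₀]·L`.
[cite: HaoLoeffler2025, Thm. 3.5, remark; §4 Thm. 4.9 (arXiv:2405.12611)] [cite: Robert2000PadicAnalysis, Ch. VI §2.1, §2.4]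
[cite: Gouvea1993PadicNumbers, §5.6 Cor. 5.6.4; §5.9 Problem 194] [cite: Jacquet1972, §19 Cor. 19.15] -/
theorem exists_groupLike_of_isToricTwoVarLFunctionUpTo₂_pair (hJ : jacquet1972_functionalEquation_rankinSelbergHecke_cone)
    (hK : IsImaginaryQuadratic K) {N : ℕ} [NeZero N] (W : WeierstrassCurve ℚ)
    (Dt : Literature.NumberTheory.EllipticCurves.ModularForms.ModularParametrizationData W N)
    (hH : SatisfiesHeegnerHypothesis N K)
    {𝔭 : HeightOneSpectrum (𝓞 K)} (h3 : ((3 : ℕ) : 𝓞 K) ∈ 𝔭.asIdeal)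
    {𝔭' : HeightOneSpectrum (𝓞 K)} (h3' : ((3 : ℕ) : 𝓞 K) ∈ 𝔭'.asIdeal) (hne : 𝔭' ≠ 𝔭)
    (ι' : PadicAlgCl 3 ≃+* ℂ) (hι : Summit.BirchSwinnertonDyer.BirchSwinnertonDyer.Theorems.SchneiderFree.BranchInducesPrime 3 ι' 𝔭)
    {κ₁ κ₂ : ZpExtension K 3} {γ₁ γ₂ : absoluteGaloisGroup K} (hpair : ZpExtension.IsTopGeneratorPair κ₁ κ₂ γ₁ γ₂)
    (hur₁ : ∀ v : HeightOneSpectrum (𝓞 K), v ≠ 𝔭 → ∀ 𝔓 ∈ v.primesAbove,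
      𝔓.inertia (absoluteGaloisGroup K) ≤ κ₁.kerSubgroup)
    {ΩK : ℂ} {C X Y C' X' Y' : ℂ_[3]} {L L' : PowerSeries (UnrSeries 3)}
    (hC : C ≠ 0) (hX : X ≠ 0) (hY : Y ≠ 0) (hC' : C' ≠ 0) (hX' : X' ≠ 0) (hY' : Y' ≠ 0)
    (hL : IsToricTwoVarLFunctionUpTo₂ C X Y ι' 𝔭 𝔭' κ₁ κ₂ γ₁ γ₂ Dt.f ΩK L) (hL0 : L ≠ 0)
    (hL' : IsToricTwoVarLFunctionUpTo₂ C' X' Y' ι' 𝔭 𝔭' κ₁ κ₂ γ₁ γ₂ Dt.f ΩK L') (hL'0 : L' ≠ 0) :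
    letI : Algebra ℤ_[3] (unrIntegers 3) := (toUnr 3).toAlgebra
    ∃ (g₀ : absoluteGaloisGroup K) (k : ℕ) (a a' : PadicComplexInt 3),
      (a : ℂ_[3]) = ((3 : ℕ) : ℂ_[3]) ^ k * C ∧ (a' : ℂ_[3]) = ((3 : ℕ) : ℂ_[3]) ^ k * C' ∧
      PowerSeries.C (PowerSeries.C a) * UnrSeries.toInt₂ L' =
        PowerSeries.C (PowerSeries.C a') * UnrSeries.toInt₂
          ((PowerSeries.map (PowerSeries.C (R := unrIntegers 3))
              ((PowerSeries.binomialSeries ℤ_[3] (Multiplicative.toAdd (κ₁ g₀))).map (toUnr 3)) *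
            PowerSeries.C ((PowerSeries.binomialSeries ℤ_[3] (Multiplicative.toAdd (κ₂ g₀))).map (toUnr 3))) * L) := by
  letI : Algebra ℤ_[3] (unrIntegers 3) := (toUnr 3).toAlgebra
  -- the frame involution data (only to call the character grid) and the grid with its two base characters
  obtain ⟨c, hc⟩ := FrameInvolution.exists_not_mem_range_absGaloisRestrict_rat hK
  obtain ⟨τ, hτ⟩ := FrameInvolution.exists_conjInv hK.1 c
  obtain ⟨r₁, r₂, u, v₁, v₂, m, hm, hr₁κ, hr₂κ, hr₁γ₁, hr₁γ₂, hr₂γ₁, hr₂γ₂, hu, hv₁, hv₂, hut, hv₂t, grid⟩ :=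
    CharacterGrid.characterGrid hJ (by norm_num) hK W Dt hH h3 h3' hne ι' hι hpair hur₁ hc hτ
  choose ψ r Lc hinf hunr hr hrκ hLd hLe hprod hx hy using grid
  -- size invariance: `‖X′‖ = ‖X‖`, `‖Y′‖ = ‖Y‖`
  obtain ⟨hXX, hYY⟩ := FrameSizeInvariance.norm_eq_norm_of_isToricTwoVarLFunctionUpTo₂_pair hJ hK W Dt hH h3 h3' hne ι' hι hpair hur₁
    hC hX hY hC' hX' hY' hL hL0 hL' hL'0
  -- the twist parameters `α = (X′/X)^m`, `β = (Y′/Y)^m`, `cc = C′/C`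
  set α : ℂ_[3] := (X' * X⁻¹) ^ m with hα
  set β : ℂ_[3] := (Y' * Y⁻¹) ^ m with hβ
  set cc : ℂ_[3] := C' * C⁻¹ with hcc
  have hα0 : α ≠ 0 := pow_ne_zero _ (mul_ne_zero hX' (inv_ne_zero hX))
  have hβ0 : β ≠ 0 := pow_ne_zero _ (mul_ne_zero hY' (inv_ne_zero hY))
  have hcc0 : cc ≠ 0 := mul_ne_zero hC' (inv_ne_zero hC)
  have hβ1 : ‖β‖ = 1 := by
    rw [hβ, norm_pow, norm_mul, norm_inv, ← hYY, mul_inv_cancel₀ (norm_ne_zero_iff.mpr hY), one_pow]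
  -- bookkeeping of the grid (as in `…SizeRigidity`, `…FrameFunctionalEquation`)
  have h31 : ‖((3 : ℕ) : ℂ_[3])‖ < 1 := norm_prime_padicComplex_lt_one
  have h30 : ((3 : ℕ) : ℂ_[3]) ≠ 0 := by exact_mod_cast (show (3 : ℕ) ≠ 0 by norm_num)
  have hc0 : 0 < ‖((3 : ℕ) : ℂ_[3])‖ := norm_pos_iff.mpr h30
  have hu1 : ‖u - 1‖ ≤ 1 := (hu.trans h31).le
  have hv₁1 : ‖v₁ - 1‖ ≤ 1 := (hv₁.trans h31).le
  have hv₂1 : ‖v₂ - 1‖ ≤ 1 := (hv₂.trans h31).le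
  have hu_ne : u ≠ 0 := fun h ↦ by rw [h, zero_sub, norm_neg, norm_one] at hu; exact (lt_irrefl _) (hu.trans h31)
  have hv₁_ne : v₁ ≠ 0 := fun h ↦ by rw [h, zero_sub, norm_neg, norm_one] at hv₁; exact (lt_irrefl _) (hv₁.trans h31)
  have hv₂_ne : v₂ ≠ 0 := fun h ↦ by rw [h, zero_sub, norm_neg, norm_one] at hv₂; exact (lt_irrefl _) (hv₂.trans h31)
  have hv₁n : ‖v₁‖ ≤ 1 := RamifiedSevenEllipticUnits.LemmaXi.norm_le_one_of_norm_sub_one_le_one hv₁1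
  have hv₁pow : ∀ j : ℕ, ‖v₁ ^ (j + 1) - 1‖ < ‖((3 : ℕ) : ℂ_[3])‖ := fun j ↦
    (RamifiedSevenEllipticUnits.LemmaXi.norm_pow_sub_one_le hv₁1 _).trans_lt hv₁
  have hv₂pow : ∀ j : ℕ, ‖v₂ ^ (j + 1) - 1‖ ≤ ‖((3 : ℕ) : ℂ_[3])‖ := fun j ↦
    ((RamifiedSevenEllipticUnits.LemmaXi.norm_pow_sub_one_le hv₂1 _).trans_lt hv₂).le
  have hpt : ∀ i j : ℕ, ‖v₁ ^ (j + 1) * u ^ (i + 1) - 1‖ ≤ ‖((3 : ℕ) : ℂ_[3])‖ := fun i j ↦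
    (FibredSupply.norm_mul_sub_one_lt (by rw [norm_pow]; exact pow_le_one₀ (norm_nonneg _) hv₁n) (hv₁pow j)
      ((RamifiedSevenEllipticUnits.LemmaXi.norm_pow_sub_one_le hu1 _).trans_lt hu)).le
  have hxlt : ∀ i j : ℕ, ‖v₁ ^ (j + 1) * u ^ (i + 1) - 1‖ < 1 := fun i j ↦ (hpt i j).trans_lt h31
  have hylt : ∀ j : ℕ, ‖v₂ ^ (j + 1) - 1‖ < 1 := fun j ↦ (hv₂pow j).trans_lt h31
  have hut1 : ∀ t : ℕ, ‖u ^ t - 1‖ ≤ ‖((3 : ℕ) : ℂ_[3])‖ := fun t ↦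
    ((RamifiedSevenEllipticUnits.LemmaXi.norm_pow_sub_one_le hu1 t).trans_lt hu).le
  have hinjD : Function.Injective fun j : ℕ ↦ v₂ ^ (j + 1) - 1 := by
    simpa only [one_mul] using FibredSupply.injective_mul_pow_sub_one one_ne_zero hv₂_ne hv₂t
  have hinjF : ∀ j : ℕ, Function.Injective fun i : ℕ ↦ v₁ ^ (j + 1) * u ^ (i + 1) - 1 := fun j ↦
    FibredSupply.injective_mul_pow_sub_one (pow_ne_zero _ hv₁_ne) hu_ne hut
  -- the common display values and the two value families on the grid
  obtain ⟨D, hD⟩ : ∃ D : ℕ → ℕ → ℂ_[3], ∀ i j, D i j =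
      (((ι'.symm (toricInterpolationValue 3 Dt.f 𝔭 𝔭' (ψ i j) (m * (i + 1)) (m * (j + 1)) ΩK (Lc i j 1))) : PadicAlgCl 3) :
        ℂ_[3]) := ⟨_, fun _ _ ↦ rfl⟩
  obtain ⟨VL, hVL⟩ : ∃ VL : ℕ → ℕ → ℂ_[3], ∀ i j, VL i j = C * X ^ (m * (i + 1)) * Y ^ (m * (j + 1)) * D i j :=
    ⟨_, fun _ _ ↦ rfl⟩
  obtain ⟨VL', hVL'⟩ : ∃ VL' : ℕ → ℕ → ℂ_[3], ∀ i j, VL' i j = C' * X' ^ (m * (i + 1)) * Y' ^ (m * (j + 1)) * D i j :=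
    ⟨_, fun _ _ ↦ rfl⟩
  have ha : ∀ i : ℕ, 1 ≤ m * (i + 1) := fun i ↦ Nat.mul_pos hm (Nat.succ_pos i)
  have hvalL : ∀ i j, UnrSeries.HasValueAt₂ L (v₁ ^ (j + 1) * u ^ (i + 1) - 1) (v₂ ^ (j + 1) - 1) (VL i j) := by
    intro i j
    have h := hL (ψ i j) _ _ (ha i) (ha j) (hinf i j) (hunr i j) (r i j) (hr i j) (hrκ i j) (Lc i j) (hLd i j) (hLe i j)
    rw [hx i j, hy i j, ← hD] at h
    rwa [hVL]
  have hvalL' : ∀ i j, UnrSeries.HasValueAt₂ L' (v₁ ^ (j + 1) * u ^ (i + 1) - 1) (v₂ ^ (j + 1) - 1) (VL' i j) := by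
    intro i j
    have h := hL' (ψ i j) _ _ (ha i) (ha j) (hinf i j) (hunr i j) (r i j) (hr i j) (hrκ i j) (Lc i j) (hLd i j) (hLe i j)
    rw [hx i j, hy i j, ← hD] at h
    rwa [hVL']
  -- the relation of the two value families: `VL′ = cc · α^{i+1} · β^{j+1} · VL`
  have hVLd : ∀ i j, VL' i j = α ^ (i + 1) * (cc * β ^ (j + 1)) * VL i j := by
    intro i j
    rw [hVL, hVL', hα, hβ, hcc, ← pow_mul, ← pow_mul, mul_pow, mul_pow, inv_pow, inv_pow]
    field_simp
  -- ### (0) `3`-power scaling of the constants into `𝒪_{ℂ₃}`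
  obtain ⟨k, hk⟩ := exists_norm_pow_mul_le_one (p := 3) (max ‖cc‖ (max ‖C‖ ‖C'‖))
  have hk3 : ‖((3 : ℕ) : ℂ_[3]) ^ k‖ = ‖((3 : ℕ) : ℂ_[3])‖ ^ k := norm_pow _ _
  have hkcc : ‖((3 : ℕ) : ℂ_[3]) ^ k * cc‖ ≤ 1 := by
    rw [norm_mul, hk3]; exact (mul_le_mul_of_nonneg_left (le_max_left _ _) (pow_nonneg (norm_nonneg _) _)).trans hk
  have hkC : ‖((3 : ℕ) : ℂ_[3]) ^ k * C‖ ≤ 1 := by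
    rw [norm_mul, hk3]
    exact (mul_le_mul_of_nonneg_left ((le_max_left _ _).trans (le_max_right _ _)) (pow_nonneg (norm_nonneg _) _)).trans hk
  have hkC' : ‖((3 : ℕ) : ℂ_[3]) ^ k * C'‖ ≤ 1 := by
    rw [norm_mul, hk3]
    exact (mul_le_mul_of_nonneg_left ((le_max_right _ _).trans (le_max_right _ _)) (pow_nonneg (norm_nonneg _) _)).trans hk
  set cst : ℂ_[3] := ((3 : ℕ) : ℂ_[3]) ^ k * cc with hcst
  have hcst0 : cst ≠ 0 := mul_ne_zero (pow_ne_zero _ h30) hcc0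
  -- the scaled second frame `G = 3^k · L′` and its values
  set G : PowerSeries (UnrSeries 3) := PowerSeries.C (PowerSeries.C (((3 : ℕ) : unrIntegers 3) ^ k)) * L' with hGdef
  have h3coe : (((((3 : ℕ) : unrIntegers 3) ^ k : unrIntegers 3)) : ℂ_[3]) = ((3 : ℕ) : ℂ_[3]) ^ k := by push_cast; rfl
  obtain ⟨VG, hVG⟩ : ∃ VG : ℕ → ℕ → ℂ_[3], ∀ i j, VG i j = ((3 : ℕ) : ℂ_[3]) ^ k * VL' i j := ⟨_, fun _ _ ↦ rfl⟩
  have hvalG : ∀ i j, UnrSeries.HasValueAt₂ G (v₁ ^ (j + 1) * u ^ (i + 1) - 1) (v₂ ^ (j + 1) - 1) (VG i j) := by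
    intro i j
    have h := hasValueAt₂_C_C_mul (((3 : ℕ) : unrIntegers 3) ^ k) (hvalL' i j)
    rw [h3coe] at h
    rwa [hVG]
  have hVGd : ∀ i j, VG i j = α ^ (i + 1) * (cst * β ^ (j + 1)) * VL i j := by
    intro i j; rw [hVG, hVLd, hcst]; ring
  -- ### (1) WILD STEP in the first variable: `α = Q₁(u − 1)` on a fibre with a non-vanishing node
  have hex : ∃ j₀ i₀ : ℕ, VL i₀ j₀ ≠ 0 := by
    by_contra hall
    push Not at hall
    apply hL0
    refine ReflectionTransfer.unr_eq_zero_of_infinite_zeros₂_innerFibred h30 h31 (Set.infinite_range_of_injective hinjD) ?_ ?_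
    · rintro y ⟨j, rfl⟩; exact hv₂pow j
    · rintro y ⟨j, rfl⟩
      refine Set.infinite_of_injective_forall_mem (hinjF j) fun i ↦ ⟨hpt i j, ?_⟩
      have hv := hvalL i j
      rwa [hall j i] at hv
  obtain ⟨j₀, i₀, hne0⟩ := hex
  obtain ⟨F, hFint, hFval⟩ := NodeSeries.exists_fibreSeries L (hylt j₀)
  obtain ⟨F', hF'int, hF'val⟩ := NodeSeries.exists_fibreSeries G (hylt j₀)
  have hFL : ∀ i : ℕ, ∑' n, PowerSeries.coeff n F * (v₁ ^ (j₀ + 1) * u ^ (i + 1) - 1) ^ n = VL i j₀ := fun i ↦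
    ((hFval _ _ (hxlt i j₀)).mp (hvalL i j₀)).tsum_eq
  have hFG : ∀ i : ℕ, ∑' n, PowerSeries.coeff n F' * (v₁ ^ (j₀ + 1) * u ^ (i + 1) - 1) ^ n = VG i j₀ := fun i ↦
    ((hF'val _ _ (hxlt i j₀)).mp (hvalG i j₀)).tsum_eq
  obtain ⟨i₁, hi₁⟩ := NodeSeries.exists_forall_le_ne_zero hFint hc0 h31 (hinjF j₀) (fun i ↦ hpt i j₀) (i₀ := i₀)
    (by simpa only [hFL] using hne0)
  have hVLne : ∀ t : ℕ, VL (i₁ + t) j₀ ≠ 0 := fun t ↦ by rw [← hFL]; exact hi₁ _ (Nat.le_add_right _ _)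
  set a₀ : ℂ_[3] := v₁ ^ (j₀ + 1) * u ^ (i₁ + 1) with ha₀_def
  have hξ : ‖a₀ - 1‖ ≤ ‖((3 : ℕ) : ℂ_[3])‖ := hpt i₁ j₀
  have ha₀1 : ‖a₀‖ ≤ 1 := RamifiedSevenEllipticUnits.LemmaXi.norm_le_one_of_norm_sub_one_le_one (hξ.trans h31.le)
  obtain ⟨H, hHint, hHval⟩ := NodeSeries.exists_recenter_rescale hFint hc0 h31 hξ ha₀1
  obtain ⟨H', hH'int, hH'val⟩ := NodeSeries.exists_recenter_rescale hF'int hc0 h31 hξ ha₀1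
  have hnode : ∀ t : ℕ, a₀ * (u ^ t - 1) + (a₀ - 1) = v₁ ^ (j₀ + 1) * u ^ (i₁ + t + 1) - 1 := fun t ↦ by
    rw [ha₀_def]; ring
  have hHL : ∀ t : ℕ, ∑' n, PowerSeries.coeff n H * (u ^ t - 1) ^ n = VL (i₁ + t) j₀ := fun t ↦ by
    rw [hHval _ (hut1 t), hnode, hFL]
  have hHG : ∀ t : ℕ, ∑' n, PowerSeries.coeff n H' * (u ^ t - 1) ^ n = VG (i₁ + t) j₀ := fun t ↦ by
    rw [hH'val _ (hut1 t), hnode, hFG]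
  set c₀ : ℂ_[3] := cst * β ^ (j₀ + 1) * α ^ (i₁ + 1) with hc₀
  have hc₀0 : c₀ ≠ 0 := mul_ne_zero (mul_ne_zero hcst0 (pow_ne_zero _ hβ0)) (pow_ne_zero _ hα0)
  have hrelt : ∀ t : ℕ, ∑' n, PowerSeries.coeff n H' * (u ^ t - 1) ^ n =
      c₀ * α ^ t * ∑' n, PowerSeries.coeff n H * (u ^ t - 1) ^ n := by
    intro t
    rw [hHL, hHG, hVGd, hc₀, show i₁ + t + 1 = (i₁ + 1) + t by ring, pow_add]
    ring
  have h00 : ∑' n, PowerSeries.coeff n H * (u ^ 0 - 1) ^ n ≠ 0 := by rw [hHL]; exact hVLne 0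
  obtain ⟨z, Q, hHQ, hODE, hQbd⟩ :=
    PadicComplex.exists_padicInt_binomial_twist_of_node_values hHint hH'int (hu.trans h31) hut hc₀0 hα0 hrelt h00
  have hQres : PowerSeries.IsRestricted ‖((3 : ℕ) : ℂ_[3])‖ Q := isRestricted_of_norm_coeff_le hQbd hc0.le h31
  have hHres : PowerSeries.IsRestricted ‖((3 : ℕ) : ℂ_[3])‖ H := isRestricted_of_norm_coeff_le hHint hc0.le h31
  have hQt : ∀ t : ℕ, ∑' n, PowerSeries.coeff n Q * (u ^ t - 1) ^ n = c₀ * α ^ t := by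
    intro t
    have h1 : (∑' n, PowerSeries.coeff n Q * (u ^ t - 1) ^ n) * VL (i₁ + t) j₀ = c₀ * α ^ t * VL (i₁ + t) j₀ := by
      rw [← hHL t, ← tsum_coeff_mul hQres hHres (hut1 t), ← hHQ, hrelt t]
    exact mul_right_cancel₀ (hVLne t) h1
  have hQ0 : PowerSeries.constantCoeff Q = c₀ := by
    have h := hQt 0
    rwa [pow_zero, sub_self, pow_zero, mul_one, ColumnTwist.tsum_coeff_mul_zero_pow] at h
  have hQ1 : ∑' n, PowerSeries.coeff n Q * (u - 1) ^ n = c₀ * α := by simpa using hQt 1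
  set Q₁ : PowerSeries ℂ_[3] := PowerSeries.C c₀⁻¹ * Q with hQ₁
  have hODE₁ : (1 + PowerSeries.X) * PowerSeries.derivative ℂ_[3] Q₁ = PowerSeries.C (((z : ℚ_[3]) : ℂ_[3])) * Q₁ := by
    rw [hQ₁, Derivation.leibniz, PowerSeries.derivative_C, smul_zero, add_zero, smul_eq_mul, ← mul_assoc, mul_comm (1 + PowerSeries.X),
      mul_assoc, hODE]
    ring
  have hQ₁0 : PowerSeries.constantCoeff Q₁ = 1 := by
    rw [hQ₁, map_mul, PowerSeries.constantCoeff_C, hQ0, inv_mul_cancel₀ hc₀0]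
  have hQ₁val : HasSum (fun n ↦ PowerSeries.coeff n Q₁ * (u - 1) ^ n) α := by
    have hsum := (summable_coeff_mul_pow hQres (x := u - 1) hu.le).hasSum
    rw [hQ1] at hsum
    have h2 := hsum.mul_left c₀⁻¹
    rw [inv_mul_cancel_left₀ hc₀0] at h2
    refine h2.congr_fun fun n ↦ ?_
    rw [hQ₁, PowerSeries.coeff_C_mul, mul_assoc]
  -- ### the group element `g₁` with `κ₁ g₁ = z`: `r₁(g₁) = α`; the twisted frame `L″ = [g₁]·L`
  obtain ⟨g₁, hg₁₁, -⟩ := hpair.exists_toAdd_apply_eq z 0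
  have hr₁g₁ : avatarValueAt r₁ g₁ = α :=
    BinomialValues.avatarValueAt_eq_of_fst hpair hr₁κ hr₁γ₂ hg₁₁ hODE₁ hQ₁0 (by rwa [hr₁γ₁])
  set w₁ : ℂ_[3] := avatarValueAt r₂ g₁ with hw₁
  have hw₁1 : ‖w₁‖ = 1 := by
    have hlt : ‖w₁ - 1‖ < 1 := norm_avatarValueAt_sub_one_lt_of_factorsThroughPair hr₂κ g₁
    have hne1 : ‖(1 : ℂ_[3])‖ ≠ ‖w₁ - 1‖ := by rw [norm_one]; exact hlt.ne'
    rw [show w₁ = 1 + (w₁ - 1) by ring, IsUltrametricDist.norm_add_eq_max_of_norm_ne_norm hne1, norm_one, max_eq_left hlt.le]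
  have hw₁0 : w₁ ≠ 0 := norm_ne_zero_iff.mp (by rw [hw₁1]; exact one_ne_zero)
  set B₁ : PowerSeries (UnrSeries 3) := PowerSeries.map (PowerSeries.C (R := unrIntegers 3))
      ((PowerSeries.binomialSeries ℤ_[3] (Multiplicative.toAdd (κ₁ g₁))).map (toUnr 3)) *
    PowerSeries.C ((PowerSeries.binomialSeries ℤ_[3] (Multiplicative.toAdd (κ₂ g₁))).map (toUnr 3)) with hB₁
  have hvalL'' : ∀ i j, UnrSeries.HasValueAt₂ (B₁ * L) (v₁ ^ (j + 1) * u ^ (i + 1) - 1) (v₂ ^ (j + 1) - 1)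
      (α ^ (i + 1) * w₁ ^ (j + 1) * VL i j) := by
    intro i j
    have hB := GradingRenormalisation.hasValueAt₂_groupLike hpair (hrκ i j) g₁
    rw [hx i j, hy i j, hprod, hr₁g₁] at hB
    exact LineValue.hasValueAt₂_mul (hxlt i j) (hylt j) hB (hvalL i j)
  set w : ℂ_[3] := β * w₁⁻¹ with hw_def
  have hw0 : w ≠ 0 := mul_ne_zero hβ0 (inv_ne_zero hw₁0)
  have hwn : ‖w‖ ≤ 1 := by rw [hw_def, norm_mul, norm_inv, hβ1, hw₁1, inv_one, mul_one]
  have hvalGw : ∀ i j, UnrSeries.HasValueAt₂ G (v₁ ^ (j + 1) * u ^ (i + 1) - 1) (v₂ ^ (j + 1) - 1)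
      (cst * w ^ (j + 1) * (α ^ (i + 1) * w₁ ^ (j + 1) * VL i j)) := by
    intro i j
    have h := hvalG i j
    have hww : w * w₁ = β := by rw [hw_def, mul_assoc, inv_mul_cancel₀ hw₁0, mul_one]
    have e : VG i j = cst * w ^ (j + 1) * (α ^ (i + 1) * w₁ ^ (j + 1) * VL i j) := by
      rw [hVGd, ← hww, mul_pow]; ring
    rwa [e] at h
  have hB₁L0 : B₁ * L ≠ 0 := by
    intro h0
    exact hL0 (((FrameUniqueness.isUnit_groupLike (p := 3) _ _).mul_right_eq_zero).mp h0)
  -- ### (2) COLUMN TWIST WITH A CONSTANT in the second variable: `w = Q₂(v₂ − 1)`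
  obtain ⟨e, Q₂, hODE₂, hQ₂0, -, hQ₂val⟩ :=
    ColumnTwistConst.exists_binomial_of_column_twist_const (x := fun i j ↦ v₁ ^ (j + 1) * u ^ (i + 1) - 1) hpt hinjF hv₂ hv₂t hwn hw0
      hkcc hcst0 hvalL'' hvalGw hB₁L0
  -- ### the group element `g′` with coordinates `(0, e)`: `r₂(g′) = w`, `r₁(g′) = 1`
  obtain ⟨g', hg'₁, hg'₂⟩ := hpair.exists_toAdd_apply_eq 0 e
  have hr₂g' : avatarValueAt r₂ g' = w :=
    BinomialValues.avatarValueAt_eq_of_snd hpair hr₂κ hg'₁ hg'₂ hODE₂ hQ₂0 (by rwa [hr₂γ₂])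
  have hr₁g' : avatarValueAt r₁ g' = 1 :=
    BinomialValues.avatarValueAt_eq_of_snd hpair hr₁κ hg'₁ hg'₂ hODE₂ hQ₂0 (by
      rw [hr₁γ₂, sub_self, ← hQ₂0]; exact FrameFunctionalEquation.hasSum_coeff_mul_zero_pow Q₂)
  -- ### (3) `g₀ = g₁ g′`: `r₁(g₀) = α`, `r₂(g₀) = β`; `[g₀]·L` has the grid values `α^{i+1} β^{j+1} VL`
  have hr₁g₀ : avatarValueAt r₁ (g₁ * g') = α := by rw [avatarValueAt_mul, hr₁g₁, hr₁g', mul_one]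
  have hr₂g₀ : avatarValueAt r₂ (g₁ * g') = β := by
    rw [avatarValueAt_mul, hr₂g', ← hw₁, hw_def, mul_comm β, ← mul_assoc, mul_inv_cancel₀ hw₁0, one_mul]
  set B : PowerSeries (UnrSeries 3) := PowerSeries.map (PowerSeries.C (R := unrIntegers 3))
      ((PowerSeries.binomialSeries ℤ_[3] (Multiplicative.toAdd (κ₁ (g₁ * g')))).map (toUnr 3)) *
    PowerSeries.C ((PowerSeries.binomialSeries ℤ_[3] (Multiplicative.toAdd (κ₂ (g₁ * g')))).map (toUnr 3)) with hB
  have hvalBL : ∀ i j, UnrSeries.HasValueAt₂ (B * L) (v₁ ^ (j + 1) * u ^ (i + 1) - 1) (v₂ ^ (j + 1) - 1)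
      (α ^ (i + 1) * β ^ (j + 1) * VL i j) := by
    intro i j
    have hBv := GradingRenormalisation.hasValueAt₂_groupLike hpair (hrκ i j) (g₁ * g')
    rw [hx i j, hy i j, hprod, hr₁g₀, hr₂g₀] at hBv
    exact LineValue.hasValueAt₂_mul (hxlt i j) (hylt j) hBv (hvalL i j)
  -- ### (4) the integral scalars `a = 3^k C`, `a′ = 3^k C′` and the identity `a·L′ = a′·[g₀]·L` in `𝒪_{ℂ₃}⟦T₁⟧⟦T₂⟧`
  set aI : PadicComplexInt 3 := ⟨((3 : ℕ) : ℂ_[3]) ^ k * C, mem_padicComplexInt_iff.mpr hkC⟩ with haI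
  set aI' : PadicComplexInt 3 := ⟨((3 : ℕ) : ℂ_[3]) ^ k * C', mem_padicComplexInt_iff.mpr hkC'⟩ with haI'
  refine ⟨g₁ * g', k, aI, aI', rfl, rfl, ?_⟩
  set Z : PowerSeries (PowerSeries (PadicComplexInt 3)) :=
    PowerSeries.C (PowerSeries.C aI) * UnrSeries.toInt₂ L' - PowerSeries.C (PowerSeries.C aI') * UnrSeries.toInt₂ (B * L) with hZ
  have hvalZ : ∀ i j, IntSeries.HasValueAt₂ Z (v₁ ^ (j + 1) * u ^ (i + 1) - 1) (v₂ ^ (j + 1) - 1) 0 := by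
    intro i j
    have h1 := ((UnrSeries.hasValueAt₂_iff_toInt₂ _ _ _ _).mp (hvalL' i j)).const_mul aI
    have h2 := ((UnrSeries.hasValueAt₂_iff_toInt₂ _ _ _ _).mp (hvalBL i j)).const_mul aI'
    have h := h1.sub h2
    have e0 : (aI : ℂ_[3]) * VL' i j - (aI' : ℂ_[3]) * (α ^ (i + 1) * β ^ (j + 1) * VL i j) = 0 := by
      have hccC : cc * C = C' := by rw [hcc, mul_assoc, inv_mul_cancel₀ hC, mul_one]
      rw [hVLd]
      change ((3 : ℕ) : ℂ_[3]) ^ k * C * (α ^ (i + 1) * (cc * β ^ (j + 1)) * VL i j) -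
        ((3 : ℕ) : ℂ_[3]) ^ k * C' * (α ^ (i + 1) * β ^ (j + 1) * VL i j) = 0
      rw [← hccC]; ring
    rwa [e0] at h
  have hzero : Z = 0 := by
    -- the inner values `v₂^{j+1} − 1` as elements of `𝒪_{ℂ₃}`
    set D₂ : Set (PadicComplexInt 3) := Set.range fun j : ℕ ↦
      (⟨v₂ ^ (j + 1) - 1, mem_padicComplexInt_iff.mpr (hylt j).le⟩ : PadicComplexInt 3) with hD₂
    have hinjD' : Function.Injective fun j : ℕ ↦
        (⟨v₂ ^ (j + 1) - 1, mem_padicComplexInt_iff.mpr (hylt j).le⟩ : PadicComplexInt 3) :=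
      fun j j' h ↦ hinjD (congrArg (fun c : PadicComplexInt 3 ↦ (c : ℂ_[3])) h)
    refine ReflectionTransfer.int_eq_zero_of_infinite_zeros₂_innerFibred h30 h31 (Set.infinite_range_of_injective hinjD') ?_ ?_
    · rintro a ⟨j, rfl⟩; exact hv₂pow j
    · rintro a ⟨j, rfl⟩
      refine Set.infinite_of_injective_forall_mem (hinjF j) fun i ↦ ⟨hpt i j, ?_⟩
      exact hvalZ i j
  exact sub_eq_zero.mp hzero

end Summit.BirchSwinnertonDyer.BirchSwinnertonDyer.Theorems.UniversalToricDescentThinComb.FrameOrbit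

end
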